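import Mathlib

/-!
# The Konno–Konno-normalised weights of the period closer's archimedean data (T3.1 §4.7, seat t3-p1)

Konno–Konno 2007 Lemma 5.3 (case `dψ < 0`, as read): for the real dual pair `(U(V), U(W))` with
`V` of signature `(p, q)`, `m = p + q`, and `W` of signature `(p', q')`, the joint highest weight
vector `Δ_{abcd}` has `𝔱_W`-weight `((m + p - q)/2 + a_i` on the `p'`-block `; (m + q - p)/2 + d_i`
on the `q'`-block`)`, and `𝔱_V`-weight `((m' + q' - p')/2 - a_i ; …)`.  Write
`W⁺(p, q, a) := ((p + q) + p - q)/2 + a`, `W⁻(p, q, d) := ((p + q) + q - p)/2 + d` and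
`L(p', q', a) := ((p' + q') + q' - p')/2 - a` (the `U(L)`-weight of `Δ_a` in the pair `(L, W)`).
This file records, as integer identities with the expressions written out, the KK-normalised
weights used in PERIOD.md §4.7: the `U(W_v)`-type of the fixed datum of the pair `(W, V)` and the
`U(W_v)`-types of the lifts from a line `L` in the pair `(L, W)`, at the three kinds of real
places.  It is a record of the table's arithmetic only; the matching of the two normalisations is
done in §4.7 by the choice of the splitting data (their ratio has even archimedean weight) and NO
parity obstruction exists — an earlier version of this file drew odd/even conclusions from these
numbers; those are withdrawn.  The file declares no definition and no notation.
-/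

namespace HodgeRepro.T3P1

/-- At `w₀` (`V` of signature `(2,1)`, `W` definite): the Kudla–Millson `(2,0)`-form is `Δ` with
`a₁ = a₂ = 1`, of KK-normalised `U(W)`-type `det^3` — `W⁺(2, 1, 1) = 3`; the `(L, W)`-vacuum for
`L` of signature `(1,0)` has type `det^1` — `W⁺(1, 0, 0) = 1`; for `L` of signature `(0,1)`,
`det^0` — `W⁺(0, 1, 0) = 0`. -/
theorem table_w0 :
    (((2 : ℤ) + 1) + 2 - 1) / 2 + 1 = 3 ∧ (((1 : ℤ) + 0) + 1 - 0) / 2 + 0 = 1 ∧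
      (((0 : ℤ) + 1) + 0 - 1) / 2 + 0 = 0 := by
  exact ⟨by decide, by decide, by decide⟩

/-- At a definite place (`V` of signature `(3,0)`, `W` definite): the Gaussian has KK-normalised
type `det^3` — `W⁺(3, 0, 0) = 3`. -/
theorem table_definite : (((3 : ℤ) + 0) + 3 - 0) / 2 + 0 = 3 := by decide

/-- At a mixed place (`V` of signature `(3,0)`, `W` of signature `(1,1)`): the Gaussian's lowest
`K`-type is `(W⁺(3,0,0); W⁻(3,0,0)) = (3; 0)`; the `(L, W)`-lifts for `L` of signature `(1,0)`
have lowest `K`-types `(W⁺(1,0,a); W⁻(1,0,0)) = (1 + a; 0)`, so `a = 2` gives `(3; 0)`; for `L` of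
signature `(0,1)` the vacuum is `(W⁺(0,1,0); W⁻(0,1,0)) = (0; 1)`. -/
theorem table_mixed :
    ((((3 : ℤ) + 0) + 3 - 0) / 2 + 0, (((3 : ℤ) + 0) + 0 - 3) / 2 + 0) = (3, 0) ∧
    ((((1 : ℤ) + 0) + 1 - 0) / 2 + 2, (((1 : ℤ) + 0) + 0 - 1) / 2 + 0) = (3, 0) ∧
    ((((0 : ℤ) + 1) + 0 - 1) / 2 + 0, (((0 : ℤ) + 1) + 1 - 0) / 2 + 0) = (0, 1) := by
  exact ⟨by decide, by decide, by decide⟩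

/-- The `U(L)`-weights of the matching members with `L` positive: `L(2, 0, 0) = 0` at `w₀` and
at the definite places (`a = 0`, `W` definite), `L(1, 1, 2) = -1` at the mixed places (`a = 2`,
`W` of signature `(1,1)`). -/
theorem beta_weights :
    (((2 : ℤ) + 0) + 0 - 2) / 2 - 0 = 0 ∧ (((1 : ℤ) + 1) + 1 - 1) / 2 - 2 = -1 := by
  exact ⟨by decide, by decide⟩

end HodgeRepro.T3P1
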